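import Mathlib.Algebra.Colimit.DirectLimit
import Literature.RingTheory.Etale.IndEtaleFactorization
import Literature.AlgebraicGeometry.Motives.EtaleToProetIndEtaleAlgebra
import HarnessLib

/-!
# Ind-étale algebras: a colimit-criterion helper, the canonical diagram, and the bridge from
`IsIndEtale`

The tree has two descriptions of ind-étale algebras: `Literature.AlgebraicGeometry.Motives.IsIndEtale`
(a directed `DirectLimit` of étale algebras is `A`-isomorphic to `C`) and the factorization
criterion `Literature.RingTheory.Etale.FactorsEtale` (`IndEtaleFactorization.lean`: every map
from a finitely presented algebra factors through an étale one). This file adds, for the proof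
of Bhatt–Scholze Theorem 2.3.4:

* `IsIndColimit A G C g` — a Prop-level helper predicate recording the two consequences of
  "`C` is a filtered colimit of the `A`-algebras `G i` along `g i : G i → C`" that are used:
  every finite subset of `C` is in the range of a single `g i`, and finitely many elements of
  `G i` dying in `C` already die under some `A`-algebra map `G i → G j` over `C`. It is NOT the
  categorical notion (no transition maps, functoriality or filteredness are recorded — a single
  index with `g = id` qualifies); it is exactly what `IsIndColimit.exists_factor` (finitely
  presented algebras are compact, Stacks 00QO) consumes, and it is directly checkable for the
  constructions of §2.2 (unions of subalgebras, towers, partition refinements, coproducts) as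
  well as for Mathlib's `DirectLimit` (`isIndColimit_directLimit`).
* `IsIndColimit.factorsEtale` — such a "colimit" of algebras satisfying the criterion satisfies
  it; `FactorsEtale.pi₀` — finite products indexed by a type in `Type` (the tree's
  `FactorsEtale.pi` has the index type in `Type u`).
* `IsIndEtale.factorsEtale` — **the tree's ind-étale algebras satisfy the criterion**.
* `EtaleOver A C` and `FactorsEtale.exists_range`, `FactorsEtale.exists_kill`,
  `FactorsEtale.isIndColimit` — conversely an algebra satisfying the criterion is the filtered
  colimit of the étale `A`-algebras over it (the canonical diagram, indexed by finitely
  presented quotients of polynomial rings so that the index type is small; this is the datum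
  consumed by the pro-étale comparison `nonempty_addEquiv_sheafH_etaleToProetPullback_of_indEtale`).

## References

* B. Bhatt, P. Scholze, *The pro-étale topology for schemes*, Astérisque 369 (2015)
  (arXiv:1309.1198, held): Def. 2.2.1, Prop. 2.3.3 (1),(4) and its proof, Thm. 2.3.4.
  [BhattScholze2015]
* The Stacks Project, Tag 097H (ind-étale ring maps), Tag 00QO (finite presentation and
  colimits). [StacksProject]

## Design notes

* Theorems and real definitions only (D-0026); the ind-étale notion is NOT redefined: everything
  is stated for the tree's `FactorsEtale` / `IsIndEtale`.
* All rings live in one universe `u`; the index type of `IsIndColimit` is arbitrary.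
* Mathlib searched/used: `Algebra.FinitePresentation` (`out`, `quotient`),
  `AlgHom.liftOfSurjective`, `DirectLimit` (`Algebra.of`, `of_f`, `exists_eq_mk`,
  `Quotient.exact`), `Algebra.Etale` for `Π`. Nothing restated.
-/

universe u

namespace Literature.RingTheory.Etale

open MvPolynomial

variable (A : Type u) [CommRing A]

variable {A}

/-! ### Filtered colimits, Prop-level, and compactness of finitely presented algebras -/

variable (A) in
/-- Helper predicate: **the two consequences of "`C` is a filtered colimit of the `A`-algebras
`G i` along `g i : G i → C`" used in this library** — every finite subset of `C` is in the range
of a single `g i`, and finitely many elements of some `G i` that vanish in `C` are killed by an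
`A`-algebra map `G i → G j` compatible with the maps to `C`. This is NOT the categorical
filtered-colimit notion: no transition maps, functoriality or filteredness are part of the data
(a single index with `g = id` qualifies); the two properties are exactly what
`IsIndColimit.exists_factor` consumes. For an honest directed system with colimit `C` they hold
(`isIndColimit_directLimit`). [folklore] -/
structure IsIndColimit {ι : Type*} (G : ι → Type u) [∀ i, CommRing (G i)] [∀ i, Algebra A (G i)]
    (C : Type u) [CommRing C] [Algebra A C] (g : ∀ i, G i →ₐ[A] C) : Prop where
  /-- every finite subset of `C` comes from a single stage -/
  exists_range : ∀ s : Finset C, ∃ i, (s : Set C) ⊆ Set.range (g i)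
  /-- finitely many elements dying in `C` die under a transition map over `C` -/
  exists_kill : ∀ (i : ι) (s : Finset (G i)), (∀ x ∈ s, g i x = 0) →
    ∃ (j : ι) (t : G i →ₐ[A] G j), (g j).comp t = g i ∧ ∀ x ∈ s, t x = 0

namespace IsIndColimit

variable {ι : Type*} {G : ι → Type u} [∀ i, CommRing (G i)] [∀ i, Algebra A (G i)]
  {C : Type u} [CommRing C] [Algebra A C] {g : ∀ i, G i →ₐ[A] C}

/-- The index type of a filtered colimit presentation is nonempty. [folklore] -/
theorem nonempty (h : IsIndColimit A G C g) : Nonempty ι := by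
  obtain ⟨i, -⟩ := h.exists_range ∅
  exact ⟨i⟩

/-- **Finitely presented algebras are compact** (Stacks 00QO): an `A`-algebra map from a
finitely presented `A`-algebra into a filtered colimit factors through a stage.
[cite: StacksProject, Tag 00QO] -/
theorem exists_factor (h : IsIndColimit A G C g) (P : Type u) [CommRing P] [Algebra A P]
    [Algebra.FinitePresentation A P] (φ : P →ₐ[A] C) :
    ∃ (i : ι) (ψ : P →ₐ[A] G i), (g i).comp ψ = φ := by
  classical
  obtain ⟨n, f, hf, hker⟩ := Algebra.FinitePresentation.out (R := A) (A := P)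
  -- generators: a stage containing the images of the variables
  obtain ⟨i, hi⟩ := h.exists_range (Finset.univ.image fun k : Fin n => φ (f (X k)))
  have hy : ∀ k : Fin n, ∃ y : G i, g i y = φ (f (X k)) := fun k =>
    hi (Finset.mem_coe.2 (Finset.mem_image.2 ⟨k, Finset.mem_univ _, rfl⟩))
  choose y hy using hy
  let ψ₀ : MvPolynomial (Fin n) A →ₐ[A] G i := MvPolynomial.aeval y
  have hψ₀ : (g i).comp ψ₀ = φ.comp f := by
    refine MvPolynomial.algHom_ext fun k => ?_
    simp only [AlgHom.comp_apply, ψ₀, MvPolynomial.aeval_X, hy]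
  -- relations: a further stage where the (finitely many) relations die
  obtain ⟨t, ht⟩ := hker
  have hkill : ∀ x ∈ t.image ψ₀, g i x = 0 := by
    intro x hx
    obtain ⟨r, hr, rfl⟩ := Finset.mem_image.1 hx
    have hr' : r ∈ RingHom.ker f.toRingHom := ht ▸ Ideal.subset_span hr
    have := congrArg (fun χ : MvPolynomial (Fin n) A →ₐ[A] C => χ r) hψ₀
    simp only [AlgHom.comp_apply] at this
    rw [this]
    change φ (f.toRingHom r) = 0
    rw [RingHom.mem_ker.1 hr', map_zero]
  obtain ⟨j, tr, htr, htr0⟩ := h.exists_kill i (t.image ψ₀) hkill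
  have hle : RingHom.ker f.toRingHom ≤ RingHom.ker (tr.comp ψ₀).toRingHom := by
    rw [← ht, Ideal.span_le]
    intro r hr
    exact htr0 _ (Finset.mem_image_of_mem ψ₀ hr)
  refine ⟨j, AlgHom.liftOfSurjective f hf (tr.comp ψ₀) hle, ?_⟩
  refine AlgHom.ext fun p => ?_
  obtain ⟨q, rfl⟩ := hf p
  rw [AlgHom.comp_apply, AlgHom.liftOfSurjective_apply, AlgHom.comp_apply, ← AlgHom.comp_apply,
    htr, ← AlgHom.comp_apply, hψ₀, AlgHom.comp_apply]

/-- Two factorizations of a map from a finitely presented algebra through stages of a filtered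
colimit need not agree, but a factorization through a stage can always be pushed to any later
stage over `C`; in particular **elements**: every element of `C` comes from some stage.
[folklore] -/
theorem exists_eq (h : IsIndColimit A G C g) (c : C) : ∃ (i : ι) (x : G i), g i x = c := by
  obtain ⟨i, hi⟩ := h.exists_range {c}
  obtain ⟨x, hx⟩ := hi (Finset.mem_coe.2 (Finset.mem_singleton_self c))
  exact ⟨i, x, hx⟩

/-- **A filtered colimit of ind-étale algebras is ind-étale** (Bhatt–Scholze, proof of
Prop. 2.3.3 (4): "finite presentation constraints"). [cite: BhattScholze2015, Prop. 2.3.3] -/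
theorem factorsEtale (h : IsIndColimit A G C g)
    (hG : ∀ i, FactorsEtale A (G i)) : FactorsEtale A C := by
  intro P _ _ _ φ
  obtain ⟨i, ψ, hψ⟩ := h.exists_factor P φ
  obtain ⟨E, _, _, _, α, β, hαβ⟩ := hG i P ψ
  exact ⟨E, inferInstance, inferInstance, inferInstance, α, (g i).comp β, by
    rw [AlgHom.comp_assoc, hαβ, hψ]⟩

/-- A filtered colimit of étale algebras is ind-étale. [cite: BhattScholze2015, Def. 2.2.1] -/
theorem factorsEtale_of_etale (h : IsIndColimit A G C g) [∀ i, Algebra.Etale A (G i)] :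
    FactorsEtale A C :=
  h.factorsEtale fun i => FactorsEtale.of_etale (G i)

end IsIndColimit

/-! ### Finite products indexed in `Type` -/

namespace FactorsEtale

/-- **Finite products, index type in `Type`** (cf. the tree's `FactorsEtale.pi`, index type in
`Type u`): factor each component through an étale algebra. [folklore] -/
theorem pi₀ {κ : Type} [Finite κ] (C : κ → Type u) [∀ k, CommRing (C k)] [∀ k, Algebra A (C k)]
    (h : ∀ k, FactorsEtale A (C k)) : FactorsEtale A (Π k, C k) := by
  intro P _ _ _ φ
  have hk : ∀ k, ∃ (E : Type u) (_ : CommRing E) (_ : Algebra A E) (_ : Algebra.Etale A E)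
      (α : P →ₐ[A] E) (β : E →ₐ[A] C k), β.comp α = (Pi.evalAlgHom A C k).comp φ :=
    fun k => h k P _
  choose E _ _ _ α β hαβ using hk
  refine ⟨Π k, E k, inferInstance, inferInstance, inferInstance, AlgHom.pi α,
    AlgHom.pi fun k => (β k).comp (Pi.evalAlgHom A E k), ?_⟩
  refine AlgHom.ext fun p => funext fun k => ?_
  have := congrArg (fun χ : P →ₐ[A] C k => χ p) (hαβ k)
  simpa using this

end FactorsEtale

/-! ### Mathlib `DirectLimit`s, and the tree's `IsIndEtale` -/

section DirectLimit

variable {ι : Type u} [Preorder ι] [IsDirectedOrder ι] [Nonempty ι]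
  {G : ι → Type u} [∀ i, CommRing (G i)] [∀ i, Algebra A (G i)]
  (f : ∀ i j, i ≤ j → G i →ₐ[A] G j) [DirectedSystem G (f · · ·)]

/-- **A directed `DirectLimit` of `A`-algebras satisfies `IsIndColimit`** (index type in
`Type u`; cf. `exists_factor_of_finitePresentation` of `IndEtaleFactorization`). [folklore] -/
theorem isIndColimit_directLimit :
    IsIndColimit A G (DirectLimit G f) (DirectLimit.Algebra.of G f) := by
  classical
  constructor
  · intro s
    -- each element comes from some stage; take a common upper bound
    have h : ∀ z : DirectLimit G f, ∃ (i : ι) (x : G i), DirectLimit.Algebra.of G f i x = z := by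
      intro z
      obtain ⟨i, x, rfl⟩ := DirectLimit.exists_eq_mk _ z
      exact ⟨i, x, rfl⟩
    choose i x hx using h
    obtain ⟨k, hk⟩ := Finset.exists_le (s.image i)
    refine ⟨k, fun z hz => ?_⟩
    have hik : i z ≤ k := hk _ (Finset.mem_image_of_mem i (Finset.mem_coe.1 hz))
    refine ⟨f (i z) k hik (x z), ?_⟩
    rw [DirectLimit.Algebra.of_f]
    exact hx z
  · intro i s hs
    -- each element dies at some later stage; take a common upper bound
    have h : ∀ y ∈ s, ∃ (k : ι) (hik : i ≤ k), f i k hik y = 0 := by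
      intro y hy
      have h0 : DirectLimit.Algebra.of G f i y = DirectLimit.Algebra.of G f i 0 := by
        rw [hs y hy, map_zero]
      obtain ⟨k, hik, hik', hk⟩ := Quotient.exact h0
      exact ⟨k, hik, by rw [hk, map_zero]⟩
    choose k hik hk using h
    let T : Finset ι := insert i (s.attach.image fun y => k y.1 y.2)
    obtain ⟨K, hK⟩ := Finset.exists_le T
    have hiK : i ≤ K := hK i (Finset.mem_insert_self _ _)
    refine ⟨K, f i K hiK, ?_, fun y hy => ?_⟩
    · ext y
      exact DirectLimit.Algebra.of_f _ _
    · have hkK : k y hy ≤ K :=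
        hK _ (Finset.mem_insert_of_mem (Finset.mem_image.2 ⟨⟨y, hy⟩, Finset.mem_attach _ _, rfl⟩))
      rw [← DirectedSystem.map_map (f := (f · · ·)) (hik y hy) hkK, hk y hy, map_zero]

end DirectLimit

/-- **The tree's ind-étale algebras satisfy the finite-presentation criterion**
(`Motives.IsIndEtale A C`: `C` is `A`-isomorphic to a directed colimit of étale `A`-algebras;
finitely presented algebras are compact in such colimits). [cite: BhattScholze2015, Prop. 2.3.3 (4)] -/
theorem _root_.Literature.AlgebraicGeometry.Motives.IsIndEtale.factorsEtale
    {C : Type u} [CommRing C] [Algebra A C]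
    (h : Literature.AlgebraicGeometry.Motives.IsIndEtale A C) : FactorsEtale A C := by
  obtain ⟨ι, _, _, _, G, _, _, _, f, _, ⟨e⟩⟩ := h
  exact (FactorsEtale.directLimit_of_etale f).of_equiv e

/-! ### The canonical presentation of an ind-étale algebra -/

section Canonical

variable (A)

/-- The (small) index type of the canonical diagram of an `A`-algebra `C`: finitely presented
quotients `A[X₁,…,Xₙ]/I` that are étale over `A`, together with an `A`-algebra map to `C`.
[folklore] -/
structure EtaleOver (C : Type u) [CommRing C] [Algebra A C] where
  /-- number of variables -/
  n : ℕ
  /-- the defining ideal -/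
  I : Ideal (MvPolynomial (Fin n) A)
  /-- the quotient is étale over `A` -/
  etale : Algebra.Etale A (MvPolynomial (Fin n) A ⧸ I)
  /-- the structure map to `C` -/
  hom : (MvPolynomial (Fin n) A ⧸ I) →ₐ[A] C

attribute [instance] EtaleOver.etale

variable {A} {C : Type u} [CommRing C] [Algebra A C]

/-- The ring of an object of the canonical diagram. [folklore] -/
abbrev EtaleOver.ring (j : EtaleOver A C) : Type u := MvPolynomial (Fin j.n) A ⧸ j.I

/-- Every étale `A`-algebra over `C` is isomorphic, over `C`, to an object of the canonical
diagram (étale ⇒ finitely presented ⇒ a quotient of a polynomial ring in finitely many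
variables). [folklore] -/
theorem EtaleOver.exists_of_etale (E : Type u) [CommRing E] [Algebra A E] [Algebra.Etale A E]
    (β : E →ₐ[A] C) : ∃ (j : EtaleOver A C) (e : j.ring ≃ₐ[A] E), β.comp e.toAlgHom = j.hom := by
  obtain ⟨n, f, hf, -⟩ := Algebra.FinitePresentation.out (R := A) (A := E)
  let e : (MvPolynomial (Fin n) A ⧸ RingHom.ker f.toRingHom) ≃ₐ[A] E :=
    Ideal.quotientKerAlgEquivOfSurjective hf
  haveI : Algebra.Etale A (MvPolynomial (Fin n) A ⧸ RingHom.ker f.toRingHom) :=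
    Algebra.Etale.of_equiv e.symm
  exact ⟨⟨n, RingHom.ker f.toRingHom, inferInstance, β.comp e.toAlgHom⟩, e, rfl⟩

/-- **An ind-étale algebra is the filtered colimit of the étale algebras over it, I**: every
finite subset of `C` is in the image of a single étale `A`-algebra over `C` (apply the
criterion to `A[X₁,…,Xₙ] → C`). [cite: BhattScholze2015, proof of Prop. 2.3.3 (4)] -/
theorem FactorsEtale.exists_range (h : FactorsEtale A C) (s : Finset C) :
    ∃ j : EtaleOver A C, (s : Set C) ⊆ Set.range j.hom := by
  classical
  -- the polynomial ring on the elements of `s`, mapping onto them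
  let n := s.card
  let x : Fin n → C := fun k => (s.equivFin.symm k : C)
  obtain ⟨E, _, _, _, α, β, hαβ⟩ := h (MvPolynomial (Fin n) A) (MvPolynomial.aeval x)
  obtain ⟨j, e, he⟩ := EtaleOver.exists_of_etale E β
  refine ⟨j, fun c hc => ?_⟩
  refine ⟨e.symm (α (X (s.equivFin ⟨c, hc⟩))), ?_⟩
  have h1 : j.hom (e.symm (α (X (s.equivFin ⟨c, hc⟩)))) = β (α (X (s.equivFin ⟨c, hc⟩))) := by
    rw [← he]
    simp
  rw [h1, ← AlgHom.comp_apply, hαβ, MvPolynomial.aeval_X]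
  simp [x]

/-- **An ind-étale algebra is the filtered colimit of the étale algebras over it, II**:
finitely many elements of an étale `A`-algebra `E → C` that die in `C` are killed by a map
`E → E'` of étale `A`-algebras over `C` (apply the criterion to the finitely presented
`E/(x₁,…,xₘ) → C`). [cite: BhattScholze2015, proof of Prop. 2.3.3 (4)] -/
theorem FactorsEtale.exists_kill (h : FactorsEtale A C) (j : EtaleOver A C) (s : Finset j.ring)
    (hs : ∀ x ∈ s, j.hom x = 0) :
    ∃ (j' : EtaleOver A C) (t : j.ring →ₐ[A] j'.ring), j'.hom.comp t = j.hom ∧ ∀ x ∈ s, t x = 0 := by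
  classical
  let K : Ideal j.ring := Ideal.span (s : Set j.ring)
  haveI : Algebra.FinitePresentation A (j.ring ⧸ K) :=
    Algebra.FinitePresentation.quotient ⟨s, rfl⟩
  have hK : ∀ a ∈ K, j.hom a = 0 := by
    intro a ha
    refine Submodule.span_induction (p := fun a _ => j.hom a = 0) (fun x hx => hs x hx)
      (map_zero _) (fun a b _ _ ha hb => by rw [map_add, ha, hb, add_zero])
      (fun r a _ ha => by rw [smul_eq_mul, map_mul, ha, mul_zero]) ha
  let φ : (j.ring ⧸ K) →ₐ[A] C := Ideal.Quotient.liftₐ K j.hom hK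
  obtain ⟨E, _, _, _, α, β, hαβ⟩ := h (j.ring ⧸ K) φ
  obtain ⟨j', e, he⟩ := EtaleOver.exists_of_etale E β
  refine ⟨j', e.symm.toAlgHom.comp (α.comp (Ideal.Quotient.mkₐ A K)), ?_, ?_⟩
  · have h1 : j'.hom.comp e.symm.toAlgHom = β := by
      rw [← he, AlgHom.comp_assoc, AlgEquiv.comp_symm, AlgHom.comp_id]
    rw [← AlgHom.comp_assoc, h1, ← AlgHom.comp_assoc, hαβ]
    refine AlgHom.ext fun a => ?_
    simp [φ]
  · intro x hx
    have hx0 : Ideal.Quotient.mkₐ A K x = 0 :=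
      (Ideal.Quotient.eq_zero_iff_mem).2 (Ideal.subset_span hx)
    change e.symm (α (Ideal.Quotient.mkₐ A K x)) = 0
    rw [hx0, map_zero, map_zero]

/-- **An ind-étale algebra is the filtered colimit of the étale `A`-algebras over it**
(`IsIndColimit` for the canonical diagram). [cite: BhattScholze2015, proof of Prop. 2.3.3 (4)] -/
theorem FactorsEtale.isIndColimit (h : FactorsEtale A C) :
    IsIndColimit A (fun j : EtaleOver A C => j.ring) C (fun j => j.hom) where
  exists_range := h.exists_range
  exists_kill := h.exists_kill

/-- Conversely, if the canonical diagram of étale algebras over `C` has colimit `C`, then `C` is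
ind-étale. [folklore] -/
theorem FactorsEtale.of_isIndColimit
    (h : IsIndColimit A (fun j : EtaleOver A C => j.ring) C (fun j => j.hom)) : FactorsEtale A C :=
  h.factorsEtale_of_etale

end Canonical

end Literature.RingTheory.Etale
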